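import Summits.ResolutionOfSingularities.ResolutionOfSingularities.Theorems.EquisingularLiftEquisingularLiftNatSingularAlongProjective
import Literature.Computability.AlgebraicComplexity.DeterminantalConormalBoundPlane
import Mathlib.RingTheory.Nullstellensatz
import Mathlib.RingTheory.Ideal.KrullsHeightTheorem
import Mathlib.RingTheory.Jacobson.Ring
import HarnessLib

/-!
# [OURS · L1 W4.5(b)] H-SING, part 2: the generic form singular along `V(P)` is IRREDUCIBLE
# (codim `V(P) ≥ 3`), and every point of `V(P)` — closed or not — is a singular point
# (crux `EquisingularLiftNat`, stmt-ResolutionOfSingularities-20038; K5-BMY inputs)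

NOT a statement of any manuscript. Helper file of the chain res-L1-w45b, sequel of
`…Theorems.EquisingularLiftEquisingularLiftNatSingularAlongProjective` (p510566, H-SING: for
`P = (g_c) ⊂ k[x₀,…,xₙ]` generated by forms and `d ≫ 0`, the generic member `G_t` of the projective
`P²`-system is a non-zero form of degree `d` in `P²` whose closed singular points are, chart by
chart, exactly the closed points of `V(P)`). The K5-BMY hand (res-D-brk-4, 2026-08-27) asked for
two extras: (i) `V(G_t)` INTEGRAL for generic `t` — the binder `IsIntegral H` of the item — and
(ii) «the stalk of `V(G_t)` at the generic point of `V(P)` is not regular» — the binder of `ULTAt`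
at `h = η_S`. Both are proved here at the level of forms and standard charts
(`Motives.ProjectiveSpace.dehomogenize`).

**(ii) Every point of `V(P)` is singular** (`not_isRegularLocalRing_quotient_of_mem_sq_prime`,
`not_isRegularLocalRing_of_map_le`): for `G ∈ P²` with `G(xᵢ := 1) ≠ 0` and EVERY prime
`𝔮 ⊇ P(xᵢ := 1)` of `k[y₁,…,yₙ]` (e.g. the generic point `η_S` of `V(P) ∩ D₊(xᵢ)` when that ideal is
prime), the local ring `k[y]_𝔮 ⧸ (G(xᵢ := 1))` of `V(G)` at `𝔮` is NOT regular: `G(xᵢ := 1) ∈ 𝔮²`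
is a non-zero element of the square of the maximal ideal of the regular local ring `k[y]_𝔮`
(Matsumura 14.2). No genericity and no algebraic closedness needed.

**(i) Irreducibility** (`irreducible_of_singular_iff`): `k` algebraically closed, `P = (g_c)`
generated by forms with `P ≠ ⊤` and `height P ≥ 3` (codimension of `V(P)` at least `3` — for
K5-BMY, `S` a surface in `ℙ⁵`), `G ≠ 0` a form in `P²` (so not a unit) satisfying the conclusion
of H-SING «a closed point of `V(G)` at which `V(G)` is singular lies on `V(P)`» on every chart.
Then `G` is IRREDUCIBLE. Proof (dimension count, no Bertini-irreducibility theorem): if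
`G = A·B` with non-units `A, B`, these are forms of positive degree
(`isHomogeneous_of_dvd_isHomogeneous`, tree), so `(A, B) ⊆ 𝔪₀ = (x₀,…,xₙ)`; a minimal prime
`Q ⊆ 𝔪₀` over `(A, B)` has `height Q ≤ 2` (Krull), hence `Q ≠ 𝔪₀` (`height 𝔪₀ = n + 1 ≥ 3`,
as `3 ≤ height P ≤ height` of a maximal ideal over `P`, and all maximal ideals of `k[x]` have height
`n + 1` by the Nullstellensatz). Every maximal `J ⊇ Q` other than `𝔪₀` is the ideal of a point
`a ≠ 0` with `A(a) = B(a) = 0`; on the chart `aᵢ ≠ 0` (rescale `a` to `aᵢ = 1`, forms!) the point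
`y = (a_j/a_i)` has `A(xᵢ:=1), B(xᵢ:=1) ∈ 𝔪_y`, so `G(xᵢ:=1) ∈ 𝔪_y²` and `V(G)` is SINGULAR at
`y`; by H-SING `y ∈ V(P)`, i.e. `P ⊆ J`. Hence `P · 𝔪₀ ⊆ ⋂_{J ⊇ Q max} J = Q` (`k[x]` is
Jacobson), so `P ⊆ Q` (`Q` prime, `Q ≠ 𝔪₀`), and `3 ≤ height P ≤ height Q ≤ 2` — contradiction.

**Packaged for the system of part 1** (`isGeneric_irreducible`,
`exists_irreducible_form_singularLocus_eq`): for generic `t` the member `G_t` is irreducible;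
a witness form `G ≠ 0` of degree `d` in `P²`, irreducible, with closed singular points exactly
the closed points of `V(P)` and every prime over `P(xᵢ:=1)` singular, exists. Consequently the
reduced hypersurface `V(G) ⊂ ℙⁿ_k` is integral with `(Sing V(G)) = V(P)` pointwise on charts —
the shape the K5-BMY skeleton consumes (scheme packaging not included, on request).

References: Hartshorne I Thm. 7.2 (projective dimension theorem, here via Krull's height
theorem) and II Thm. 8.18 [Hartshorne1977]; Matsumura Thm. 13.5 (Krull), Thm. 14.2 [Matsumura1987].
-/

set_option linter.dupNamespace false -- mandated namespace `Summit.<Summit>.<Problem>` of this single-conjunct summit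

noncomputable section

open IsLocalRing MvPolynomial

universe u v

namespace Summit.ResolutionOfSingularities.ResolutionOfSingularities.Cruxes.EquisingularLiftNat.Sections

open Literature.AlgebraicGeometry.Resolution Literature.AlgebraicGeometry.Resolution.BertiniAffine
open Literature.AlgebraicGeometry.Motives
open Literature.Computability.AlgebraicComplexity.DeterminantalConormal
  (isHomogeneous_of_dvd_isHomogeneous)

variable {k : Type u} [Field k]

/-! ## (ii) Every point of `V(P)` is a singular point of `V(G)` -/

/-- In a regular domain `A`, for a PRIME `𝔮` and `0 ≠ s ∈ 𝔮²`, the local ring `A_𝔮 ⧸ (s)` of the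
hypersurface `V(s)` at the point `𝔮` is NOT regular (the prime version of
`not_isRegularLocalRing_quotient_of_mem_sq`: `s` is a non-zero element of the square of the
maximal ideal of the regular local ring `A_𝔮`). [cite: Matsumura1987, Thm. 14.2]
[OURS · L1 W4.5b] helper for H-SING part 2; NOT a statement of the manuscript. -/
theorem not_isRegularLocalRing_quotient_of_mem_sq_prime {A : Type u} [CommRing A]
    [IsRegularRing A] [IsDomain A] (𝔮 : Ideal A) [𝔮.IsPrime] {s : A} (hs0 : s ≠ 0)
    (hs2 : s ∈ 𝔮 ^ 2) :
    ¬ IsRegularLocalRing (Localization.AtPrime 𝔮 ⧸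
        Ideal.span {algebraMap A (Localization.AtPrime 𝔮) s}) := by
  have hinj : Function.Injective (algebraMap A (Localization.AtPrime 𝔮)) :=
    IsLocalization.injective (Localization.AtPrime 𝔮) (Ideal.primeCompl_le_nonZeroDivisors 𝔮)
  have h0 : algebraMap A (Localization.AtPrime 𝔮) s ≠ 0 := fun h =>
    hs0 (hinj (by rw [h, map_zero]))
  have h2 : algebraMap A (Localization.AtPrime 𝔮) s ∈
      maximalIdeal (Localization.AtPrime 𝔮) ^ 2 := by
    rw [← Localization.AtPrime.map_eq_maximalIdeal, ← Ideal.map_pow]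
    exact Ideal.mem_map_of_mem _ hs2
  exact not_isRegularLocalRing_quotient_span_singleton_of_mem_sq h0 h2

/-- **(ii) for forms: every prime over `P(xᵢ := 1)` is a singular point of `V(G)`.** For
`G ∈ P²`, `P = (g_c)`, with `G(xᵢ := 1) ≠ 0`, and every PRIME `𝔮 ⊇ P(xᵢ := 1)` of the chart ring
`k[y₁,…,yₙ]` of `D₊(xᵢ)` — in particular the generic point `η_S` of `V(P) ∩ D₊(xᵢ)` when
`P(xᵢ := 1)` is prime — the local ring `k[y]_𝔮 ⧸ (G(xᵢ := 1))` of the hypersurface `V(G)` at `𝔮`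
is NOT regular. (The binder «the stalk of `H = V(G)` at `h = η_S` is not regular» of `ULTAt` in the
K5-BMY object.) [cite: Matsumura1987, Thm. 14.2] [OURS · L1 W4.5b] helper H-SING part 2 for crux
`EquisingularLiftNat` (stmt-ResolutionOfSingularities-20038); NOT a statement of the manuscript. -/
theorem not_isRegularLocalRing_of_map_le {n : ℕ} {γ : Type v}
    (g : γ → MvPolynomial (Fin (n + 1)) k) (i : Fin (n + 1)) {G : MvPolynomial (Fin (n + 1)) k}
    (hG : G ∈ Ideal.span (Set.range g) ^ 2) (hG0 : ProjectiveSpace.dehomogenize k i G ≠ 0)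
    (𝔮 : Ideal (MvPolynomial (Fin n) k)) [𝔮.IsPrime]
    (h𝔮 : (Ideal.span (Set.range g)).map (ProjectiveSpace.dehomogenize k i) ≤ 𝔮) :
    ¬ IsRegularLocalRing (Localization.AtPrime 𝔮 ⧸ Ideal.span {algebraMap _
        (Localization.AtPrime 𝔮) (ProjectiveSpace.dehomogenize k i G)}) := by
  refine not_isRegularLocalRing_quotient_of_mem_sq_prime 𝔮 hG0 (Ideal.pow_right_mono h𝔮 2 ?_)
  rw [← Ideal.map_pow]
  exact Ideal.mem_map_of_mem _ hG

/-! ## (i) Irreducibility of the generic form singular along `V(P)`, codim `V(P) ≥ 3` -/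

/-- The ideal of a point `x ∈ kˢ` in Mathlib's Nullstellensatz spelling (`vanishingIdeal {x}`) is
the tree's `BertiniAffine.paramIdeal x` (`ker eval x`). [folklore]
[OURS · L1 W4.5b] helper for H-SING part 2. -/
theorem vanishingIdeal_singleton_eq_paramIdeal {σ : Type v} (x : σ → k) :
    MvPolynomial.vanishingIdeal k {x} = paramIdeal x := by
  ext p
  rw [MvPolynomial.mem_vanishingIdeal_singleton_iff, mem_paramIdeal_iff]
  exact Iff.rfl

/-- **All maximal ideals of `k[x₀,…,x_N]` (`k` algebraically closed) have height `N + 1`**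
(Nullstellensatz: they are ideals of points; `BertiniAffine.height_paramIdeal`). [folklore]
[OURS · L1 W4.5b] helper for H-SING part 2. -/
theorem height_of_isMaximal_mvPolynomial [IsAlgClosed k] {N : ℕ}
    (J : Ideal (MvPolynomial (Fin N) k)) (hJ : J.IsMaximal) : J.height = N := by
  obtain ⟨x, rfl⟩ := MvPolynomial.isMaximal_iff_eq_vanishingIdeal_singleton.1 hJ
  rw [vanishingIdeal_singleton_eq_paramIdeal, height_paramIdeal, Nat.card_eq_fintype_card,
    Fintype.card_fin]

/-- A form of POSITIVE degree vanishes at the origin. [folklore]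
[OURS · L1 W4.5b] helper for H-SING part 2. -/
theorem aeval_zero_of_isHomogeneous {σ : Type v} {F : MvPolynomial σ k} {m : ℕ}
    (hF : F.IsHomogeneous m) (hm : m ≠ 0) : MvPolynomial.aeval (0 : σ → k) F = 0 := by
  have h := ProjectiveSpace.isHomogeneous_aeval_const_mul hF (0 : k) (fun _ : σ => (0 : k))
  simp only [zero_mul, zero_pow hm] at h
  exact h

/-- **Scaling a point does not change the vanishing of a form**: for `c ≠ 0`,
`F(c·a) = 0 ↔ F(a) = 0`. [folklore] [OURS · L1 W4.5b] helper for H-SING part 2. -/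
theorem aeval_smul_eq_zero_iff {σ : Type v} {F : MvPolynomial σ k} {m : ℕ}
    (hF : F.IsHomogeneous m) {c : k} (hc : c ≠ 0) (a : σ → k) :
    MvPolynomial.aeval (fun s => c * a s) F = 0 ↔ MvPolynomial.aeval a F = 0 := by
  rw [ProjectiveSpace.isHomogeneous_aeval_const_mul hF, mul_eq_zero, or_iff_right (pow_ne_zero _ hc)]

/-- A non-zero form which is not a unit has positive degree. [folklore]
[OURS · L1 W4.5b] helper for H-SING part 2. -/
theorem totalDegree_ne_zero_of_not_isUnit {σ : Type v} {A : MvPolynomial σ k} (hA0 : A ≠ 0)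
    (hAu : ¬ IsUnit A) : A.totalDegree ≠ 0 := by
  intro h0
  rw [totalDegree_eq_zero_iff_eq_C] at h0
  apply hAu
  rw [h0]
  refine (isUnit_iff_ne_zero.mpr fun hc => hA0 ?_).map C
  rw [h0, hc, map_zero]

/-- **(i) Irreducibility of a form singular exactly along `V(P)`, `codim V(P) ≥ 3`.** Let `k` be
algebraically closed, `g_c ∈ k[x₀,…,xₙ]` forms of degrees `e_c` with `P = (g_c) ≠ ⊤` and
`3 ≤ height P`, and `G ≠ 0` a form of degree `d` in `P²` such that on every chart `D₊(xᵢ)`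
«a closed point `𝔪 ∋ G(xᵢ:=1)` at which `k[y]_𝔪 ⧸ (G(xᵢ:=1))` is NOT regular contains `P(xᵢ:=1)`»
(the singular ⇒ on-`V(P)` half of H-SING). Then `G` is IRREDUCIBLE. Proof in the module
docstring: a factorisation `G = A·B` into non-units gives forms `A, B` of positive degree; a minimal
prime `Q ∋ A, B` inside `𝔪₀ = (x₀,…,xₙ)` has height `≤ 2` (Krull), so `Q ≠ 𝔪₀`; every other
maximal `J ⊇ Q` is a point `a ≠ 0` where `A(a) = B(a) = 0`, read on the chart `aᵢ ≠ 0` as a closed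
point with `G(xᵢ:=1) ∈ 𝔪_y²`, i.e. a SINGULAR point of `V(G)`, hence on `V(P)`: `P ⊆ J`; so
`P·𝔪₀ ⊆ Q` (Jacobson), `P ⊆ Q`, `3 ≤ height P ≤ height Q ≤ 2`. [cite: Hartshorne1977, I Thm. 7.2]
[cite: Matsumura1987, Thm. 13.5 and Thm. 14.2] [OURS · L1 W4.5b] helper H-SING part 2 (K5-BMY
binder `IsIntegral H`) for crux `EquisingularLiftNat` (stmt-ResolutionOfSingularities-20038); NOT a
statement of the manuscript. -/
theorem irreducible_of_singular_iff [IsAlgClosed k] {n : ℕ} {γ : Type v}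
    (g : γ → MvPolynomial (Fin (n + 1)) k) (e : γ → ℕ) (hg : ∀ c, (g c).IsHomogeneous (e c))
    (hP : Ideal.span (Set.range g) ≠ ⊤) (h3 : 3 ≤ (Ideal.span (Set.range g)).height)
    {G : MvPolynomial (Fin (n + 1)) k} {d : ℕ} (hGd : G.IsHomogeneous d) (hG0 : G ≠ 0)
    (hGP : G ∈ Ideal.span (Set.range g) ^ 2)
    (hsing : ∀ (i : Fin (n + 1)) (𝔪 : Ideal (MvPolynomial (Fin n) k)) [𝔪.IsMaximal],
      ProjectiveSpace.dehomogenize k i G ∈ 𝔪 →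
      ¬ IsRegularLocalRing (Localization.AtPrime 𝔪 ⧸ Ideal.span {algebraMap _
          (Localization.AtPrime 𝔪) (ProjectiveSpace.dehomogenize k i G)}) →
      (Ideal.span (Set.range g)).map (ProjectiveSpace.dehomogenize k i) ≤ 𝔪) :
    Irreducible G := by
  classical
  set P : Ideal (MvPolynomial (Fin (n + 1)) k) := Ideal.span (Set.range g) with hPdef
  -- `G ∈ P² ⊆ P ≠ ⊤` is not a unit
  have hGu : ¬ IsUnit G := fun hu =>
    hP (Ideal.eq_top_of_isUnit_mem _ (Ideal.pow_le_self two_ne_zero hGP) hu)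
  refine irreducible_iff.2 ⟨hGu, fun A B hAB => ?_⟩
  by_contra hcon
  rw [not_or] at hcon
  obtain ⟨hAu, hBu⟩ := hcon
  have hA0 : A ≠ 0 := fun h => hG0 (by rw [hAB, h, zero_mul])
  have hB0 : B ≠ 0 := fun h => hG0 (by rw [hAB, h, mul_zero])
  -- `A`, `B` are forms of positive degree
  have hAh : A.IsHomogeneous A.totalDegree := isHomogeneous_of_dvd_isHomogeneous hGd hG0 ⟨B, hAB⟩
  have hBh : B.IsHomogeneous B.totalDegree :=
    isHomogeneous_of_dvd_isHomogeneous hGd hG0 ⟨A, hAB.trans (mul_comm A B)⟩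
  have hApos : A.totalDegree ≠ 0 := totalDegree_ne_zero_of_not_isUnit hA0 hAu
  have hBpos : B.totalDegree ≠ 0 := totalDegree_ne_zero_of_not_isUnit hB0 hBu
  -- all maximal ideals have height `n + 1 ≥ 3`
  have hn : (3 : ℕ∞) ≤ ((n + 1 : ℕ) : ℕ∞) := by
    obtain ⟨J, hJmax, hPJ⟩ := Ideal.exists_le_maximal P hP
    calc (3 : ℕ∞) ≤ P.height := h3
      _ ≤ J.height := Ideal.height_mono hPJ
      _ = ((n + 1 : ℕ) : ℕ∞) := height_of_isMaximal_mvPolynomial J hJmax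
  -- the origin `𝔪₀ ⊇ (A, B)`, and a minimal prime `Q ⊆ 𝔪₀` over `(A, B)`
  set 𝔪₀ : Ideal (MvPolynomial (Fin (n + 1)) k) :=
    MvPolynomial.vanishingIdeal k {(0 : Fin (n + 1) → k)} with h𝔪₀
  have h𝔪₀max : 𝔪₀.IsMaximal :=
    MvPolynomial.isMaximal_iff_eq_vanishingIdeal_singleton.2 ⟨0, rfl⟩
  set I : Ideal (MvPolynomial (Fin (n + 1)) k) :=
    Ideal.span ((({A, B} : Finset (MvPolynomial (Fin (n + 1)) k)) : Set _)) with hI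
  have hAI : A ∈ I := Ideal.subset_span (by simp)
  have hBI : B ∈ I := Ideal.subset_span (by simp)
  have hIle : I ≤ 𝔪₀ := by
    rw [hI, Ideal.span_le]
    intro F hF
    simp only [Finset.coe_insert, Finset.coe_singleton, Set.mem_insert_iff,
      Set.mem_singleton_iff] at hF
    rw [SetLike.mem_coe, h𝔪₀, MvPolynomial.mem_vanishingIdeal_singleton_iff]
    rcases hF with rfl | rfl
    · exact aeval_zero_of_isHomogeneous hAh hApos
    · exact aeval_zero_of_isHomogeneous hBh hBpos
  haveI := h𝔪₀max.isPrime
  obtain ⟨Q, hQmin, hQle⟩ := Ideal.exists_minimalPrimes_le hIle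
  haveI hQprime : Q.IsPrime := hQmin.1.1
  have hIQ : I ≤ Q := hQmin.1.2
  have hQh : Q.height ≤ 2 :=
    (Ideal.height_le_card_of_mem_minimalPrimes_span_finset hQmin).trans
      (by exact_mod_cast Finset.card_le_two)
  have hQne : Q ≠ 𝔪₀ := by
    intro h
    have h1 : Q.height = ((n + 1 : ℕ) : ℕ∞) := height_of_isMaximal_mvPolynomial Q (h ▸ h𝔪₀max)
    have h2 : (3 : ℕ∞) ≤ 2 := hn.trans (h1 ▸ hQh)
    exact absurd h2 (by decide)
  -- KEY: every maximal `J ⊇ Q` other than the origin contains `P`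
  have hkey : ∀ J : Ideal (MvPolynomial (Fin (n + 1)) k), J.IsMaximal → Q ≤ J → J ≠ 𝔪₀ →
      P ≤ J := by
    intro J hJ hQJ hJne
    obtain ⟨a, rfl⟩ := MvPolynomial.isMaximal_iff_eq_vanishingIdeal_singleton.1 hJ
    have ha : a ≠ 0 := fun h => hJne (by rw [h])
    obtain ⟨i, hi⟩ := Function.ne_iff.1 ha
    have hAa : MvPolynomial.aeval a A = 0 :=
      (MvPolynomial.mem_vanishingIdeal_singleton_iff a A).1 (hQJ (hIQ hAI))
    have hBa : MvPolynomial.aeval a B = 0 :=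
      (MvPolynomial.mem_vanishingIdeal_singleton_iff a B).1 (hQJ (hIQ hBI))
    -- rescale to `aᵢ = 1` and pass to the chart `D₊(xᵢ)`
    set a' : Fin (n + 1) → k := fun s => (a i)⁻¹ * a s with ha'
    have ha'i : a' i = 1 := inv_mul_cancel₀ hi
    set y : Fin n → k := fun j => a' (i.succAbove j) with hy
    have hchart : ∀ F : MvPolynomial (Fin (n + 1)) k,
        MvPolynomial.aeval y (ProjectiveSpace.dehomogenize k i F) = MvPolynomial.aeval a' F :=
      fun F => ProjectiveSpace.eval_dehomogenize i a' ha'i F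
    set 𝔪y : Ideal (MvPolynomial (Fin n) k) := MvPolynomial.vanishingIdeal k {y} with h𝔪y
    haveI : 𝔪y.IsMaximal := MvPolynomial.isMaximal_iff_eq_vanishingIdeal_singleton.2 ⟨y, rfl⟩
    have hmemy : ∀ {F : MvPolynomial (Fin (n + 1)) k} {m : ℕ}, F.IsHomogeneous m →
        MvPolynomial.aeval a F = 0 → ProjectiveSpace.dehomogenize k i F ∈ 𝔪y := by
      intro F m hF hFa
      rw [h𝔪y, MvPolynomial.mem_vanishingIdeal_singleton_iff, hchart]
      exact (aeval_smul_eq_zero_iff hF (inv_ne_zero hi) a).2 hFa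
    have hf2 : ProjectiveSpace.dehomogenize k i G ∈ 𝔪y ^ 2 := by
      rw [hAB, map_mul, pow_two]
      exact Ideal.mul_mem_mul (hmemy hAh hAa) (hmemy hBh hBa)
    have hf0 : ProjectiveSpace.dehomogenize k i G ≠ 0 := dehomogenize_ne_zero i hGd hG0
    have hns := not_isRegularLocalRing_quotient_of_mem_sq 𝔪y hf0 hf2
    have hPy : P.map (ProjectiveSpace.dehomogenize k i) ≤ 𝔪y :=
      hsing i 𝔪y (Ideal.pow_le_self two_ne_zero hf2) hns
    -- read off: every `g_c` vanishes at `a`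
    rw [hPdef, Ideal.span_le]
    rintro _ ⟨c, rfl⟩
    rw [SetLike.mem_coe, MvPolynomial.mem_vanishingIdeal_singleton_iff,
      ← aeval_smul_eq_zero_iff (hg c) (inv_ne_zero hi) a, ← hchart]
    have hgc : ProjectiveSpace.dehomogenize k i (g c) ∈ 𝔪y :=
      hPy (Ideal.mem_map_of_mem _ (Ideal.subset_span ⟨c, rfl⟩))
    rwa [h𝔪y, MvPolynomial.mem_vanishingIdeal_singleton_iff] at hgc
  -- Jacobson: `P · 𝔪₀ ⊆ ⋂ {J max ⊇ Q} = Q`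
  have hPQ : P * 𝔪₀ ≤ Q := by
    have hJ : Q.jacobson = Q := IsJacobsonRing.out inferInstance hQprime.isRadical
    rw [← hJ]
    intro x hx
    rw [Ideal.jacobson, Ideal.mem_sInf]
    rintro J ⟨hQJ, hJmax⟩
    by_cases hJ0 : J = 𝔪₀
    · rw [hJ0]
      exact Ideal.mul_le_left hx
    · exact hkey J hJmax hQJ hJ0 (Ideal.mul_le_right hx)
  have hPleQ : P ≤ Q := by
    rcases hQprime.mul_le.1 hPQ with h | h
    · exact h
    · exact absurd (h𝔪₀max.eq_of_le hQprime.ne_top h).symm hQne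
  have h32 : (3 : ℕ∞) ≤ 2 := h3.trans ((Ideal.height_mono hPleQ).trans hQh)
  exact absurd h32 (by decide)

/-! ## Packaged for the projective `P²`-system of part 1 -/

section System

variable {n : ℕ} {γ : Type v} [Fintype γ]
  (g : γ → MvPolynomial (Fin (n + 1)) k) (e : γ → ℕ) (d : ℕ)

/-- **The generic member of the projective `P²`-system is irreducible** (`k` algebraically closed,
`P = (g_c) ≠ ⊤` of height `≥ 3`, `d ≥ e_c + e_{c'} + 1`): combine part 1's
`isGeneric_singular_iff` with `irreducible_of_singular_iff`. [cite: Hartshorne1977, I Thm. 7.2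
and II Thm. 8.18] [OURS · L1 W4.5b] helper H-SING part 2 for crux `EquisingularLiftNat`
(stmt-ResolutionOfSingularities-20038); NOT a statement of the manuscript. -/
theorem isGeneric_irreducible [IsAlgClosed k] (hg : ∀ c, (g c).IsHomogeneous (e c))
    (hne : ∃ c, g c ≠ 0) (hd : ∀ c c', e c + e c' + 1 ≤ d) (hP : Ideal.span (Set.range g) ≠ ⊤)
    (h3 : 3 ≤ (Ideal.span (Set.range g)).height) :
    IsGeneric fun t : (γ × γ) × (Fin (n + 1) × Fin (n + 1)) → k =>
      Irreducible (linComb (fun j : (γ × γ) × (Fin (n + 1) × Fin (n + 1)) =>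
        X j.2.1 ^ (d - (e j.1.1 + e j.1.2 + 1)) * X j.2.2 * (g j.1.1 * g j.1.2)) t) := by
  refine (isGeneric_singular_iff g e d hg hne hd).mono fun t ht => ?_
  refine irreducible_of_singular_iff g e hg hP h3 ht.2.1 ht.1 ht.2.2.1 fun i 𝔪 _ hf hns => ?_
  exact not_not.1 fun h => hns (((ht.2.2.2 i).2.2 𝔪 hf).2 h)

/-- **H-SING, full package for K5-BMY: an irreducible witness form.** `k` algebraically closed;
`g_c` forms of degrees `e_c`, not all zero, `P = (g_c) ≠ ⊤` with `3 ≤ height P`; `d` with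
`e_c + e_{c'} + 1 ≤ d`. Then there is a form `G` of degree `d` with: `G ≠ 0`, `G` IRREDUCIBLE,
`G ∈ P²`, and on every chart `D₊(xᵢ) = Spec k[y]` (`f = G(xᵢ := 1)`, `𝔭ᵢ = P(xᵢ := 1)`): `f ≠ 0`,
`f ∈ 𝔭ᵢ²`, for every closed point `𝔪 ∋ f`: `k[y]_𝔪 ⧸ (f)` regular iff `𝔪 ⊉ 𝔭ᵢ` (closed singular
points of `V(G)` = closed points of `V(P)`), and for every PRIME `𝔮 ⊇ 𝔭ᵢ` (every point of `V(P)`,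
in particular its generic points): `k[y]_𝔮 ⧸ (f)` is not regular. So the reduced hypersurface
`V(G) ⊂ ℙⁿ_k` is integral and singular exactly along `V(P)`. [cite: Hartshorne1977, I Thm. 7.2 and
II Thm. 8.18] [cite: Matsumura1987, Thm. 14.2] [OURS · L1 W4.5b] helper H-SING (K5-BMY inputs
«(Sing H)_red = S», `IsIntegral H`, «stalk at η_S not regular») for crux `EquisingularLiftNat`
(stmt-ResolutionOfSingularities-20038); NOT a statement of the manuscript. -/
theorem exists_irreducible_form_singularLocus_eq [IsAlgClosed k]
    (hg : ∀ c, (g c).IsHomogeneous (e c)) (hne : ∃ c, g c ≠ 0) (hd : ∀ c c', e c + e c' + 1 ≤ d)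
    (hP : Ideal.span (Set.range g) ≠ ⊤) (h3 : 3 ≤ (Ideal.span (Set.range g)).height) :
    ∃ G : MvPolynomial (Fin (n + 1)) k, G ≠ 0 ∧ G.IsHomogeneous d ∧ Irreducible G ∧
      G ∈ Ideal.span (Set.range g) ^ 2 ∧
      ∀ i : Fin (n + 1),
        ProjectiveSpace.dehomogenize k i G ≠ 0 ∧
        ProjectiveSpace.dehomogenize k i G ∈
          (Ideal.span (Set.range g)).map (ProjectiveSpace.dehomogenize k i) ^ 2 ∧
        (∀ (𝔪 : Ideal (MvPolynomial (Fin n) k)) [𝔪.IsMaximal],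
          ProjectiveSpace.dehomogenize k i G ∈ 𝔪 →
          (IsRegularLocalRing (Localization.AtPrime 𝔪 ⧸ Ideal.span {algebraMap _
              (Localization.AtPrime 𝔪) (ProjectiveSpace.dehomogenize k i G)}) ↔
            ¬ (Ideal.span (Set.range g)).map (ProjectiveSpace.dehomogenize k i) ≤ 𝔪)) ∧
        ∀ (𝔮 : Ideal (MvPolynomial (Fin n) k)) [𝔮.IsPrime],
          (Ideal.span (Set.range g)).map (ProjectiveSpace.dehomogenize k i) ≤ 𝔮 →
          ¬ IsRegularLocalRing (Localization.AtPrime 𝔮 ⧸ Ideal.span {algebraMap _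
              (Localization.AtPrime 𝔮) (ProjectiveSpace.dehomogenize k i G)}) := by
  have hgen := (isGeneric_singular_iff g e d hg hne hd).and
    (isGeneric_irreducible g e d hg hne hd hP h3)
  haveI : Infinite k := IsAlgClosed.instInfinite
  obtain ⟨t, ht, hirr⟩ := hgen.nonempty
  refine ⟨_, ht.1, ht.2.1, hirr, ht.2.2.1, fun i => ⟨(ht.2.2.2 i).1, (ht.2.2.2 i).2.1,
    fun 𝔪 _ hf => (ht.2.2.2 i).2.2 𝔪 hf, fun 𝔮 _ h𝔮 => ?_⟩⟩
  exact not_isRegularLocalRing_of_map_le g i ht.2.2.1 (ht.2.2.2 i).1 𝔮 h𝔮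

end System

end Summit.ResolutionOfSingularities.ResolutionOfSingularities.Cruxes.EquisingularLiftNat.Sections

end
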